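import Literature.NumberTheory.EllipticCurves.CPMuDescentK3Box
import Literature.NumberTheory.NumberFields.EisensteinFieldSelmerNormCubeSplit
import HarnessLib

/-!
# The `α̂`-box over `ℚ(√−3)` of the `3`-isogeny descent with ONE split prime, and `t_3(E_{m,s}) = 0` booked from
# generators on both sides (Cohen–Pazuki 2009, Thm. 2.1, Prop. 2.2) — the case `2b̂√−3` supported on `λ`, inert
# primes and one split prime `p = ϖϖ̄`

Topic `NumberTheory/EllipticCurves`. Sequel to `CPMuDescentK3Box` (inert support only). When the support of `2b̂`
(`b̂ = 3s − 4m³/9`) contains ONE rational prime `p ≡ 1 (mod 3)`, split as `p = ϖϖ̄` in `𝓞 K3` (`ϖ = a + bζ`,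
`a² − ab + b² = p`), the norm-cube box of the `μ₃`-kernel side is the `𝔽₃`-plane `⟨[ζ], [ϖ ϖ̄²]⟩`
(`K3.exists_cubeClass_eq_of_norm_cube_split`); so the `K3`-side input of the booking becomes TWO generators: `[ζ]` and
one of `[ϖ ϖ̄²]`, `[ϖ² ϖ̄]` (squares of each other) must be descent classes of points of `Ê₃(K3)`. By Cohen–Pazuki's
count `r = dim Im α + dim Im α̂ − 1` this is the shape of a rank-2 curve with `|S| = 1` — e.g. the cross-prime targets
5427b1 (`p = 67`), 9747f1 (`p = 19`), 9882e1 (`p = 61`) of route ShaPrimaryTransfer, where NO rank-2 curve with a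
rational `3`-torsion point and conductor `< 10⁴` has inert support.

* **`torsorClass_eq_zero_of_mem_sha_of_norm_cube_of_gen₂`** — the `K3`-box statement `hbox` of `CPMuDescentBoxes`
  from: `N` (inert part), `p = ϖϖ̄` (split part), the two valuation conditions at `w ∌ 3Np`, `[ζ] ∈ G` and
  (`[ϖ ϖ̄²] ∈ G` or `[ϖ² ϖ̄] ∈ G`), `G = ⟨[α̂(P)] : P ∈ Ê₃(K3)⟩`;
* **`forall_mem_sha_three_nsmul_eq_zero_of_gens_split`**, **`shaCorank_three_eq_zero_of_gens_split`** — `Ш(E/ℚ)[3] = 0`,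
  `t_3(E_{m,s}) = 0` BOOKED from `S` + one `[q] = [α(P)]` per `q ∈ S`, and the two-generator `α̂`-box per sign of `θ₀`.

## References

* [CohenPazuki2009] H. Cohen, F. Pazuki, Acta Arith. 140 (2009), Def. 1.3, Thm. 2.1, Prop. 2.2.
* [SilvermanAEC2009] J. H. Silverman, *AEC*, Thm. X.4.2 (a), Prop. VIII.1.6.
-/

noncomputable section

open scoped Classical

open WeierstrassCurve IsDedekindDomain IsDedekindDomain.HeightOneSpectrum NumberField

namespace Literature.NumberTheory.EllipticCurves

namespace CPMuDescent

open MordellDescent ThreeTorsionDescent MuThreeKernel WithZero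
open Literature.NumberTheory.NumberFields Literature.NumberTheory.NumberFields.K3

/-! ## The `K3`-box from two generators -/

/-- `[ζ^i] ∈ G` once `[ζ] ∈ G` (private copy). [cite: CohenPazuki2009, Proposition 2.2] -/
private theorem cubeClass_zeta_pow_mem' {G : Subgroup (CubeUnits K3)} (h : cubeClass (zeta : K3) ∈ G) (i : ℕ) :
    cubeClass ((zeta : K3) ^ i) ∈ G := by
  have hz : (zeta : K3) ≠ 0 := isPrimitiveRoot_zeta.ne_zero (by norm_num)
  induction i with
  | zero => rw [pow_zero, cubeClass_one]; exact G.one_mem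
  | succ n ih => rw [pow_succ, cubeClass_mul (pow_ne_zero _ hz) hz]; exact G.mul_mem ih h

/-- **`[ϖ ϖ̄²]` and `[ϖ² ϖ̄]` are squares of each other modulo cubes**: `(ϖ ϖ̄²)² = (ϖ² ϖ̄)·ϖ̄³` and
`(ϖ² ϖ̄)² = (ϖ ϖ̄²)·ϖ³`; so either generates the other in any subgroup. [cite: CohenPazuki2009, Definition 1.3] -/
theorem cubeClass_varpi_mem_and {x y : K3} (hx : x ≠ 0) (hy : y ≠ 0) {G : Subgroup (CubeUnits K3)}
    (h : cubeClass (x * y ^ 2) ∈ G ∨ cubeClass (x ^ 2 * y) ∈ G) :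
    cubeClass (x * y ^ 2) ∈ G ∧ cubeClass (x ^ 2 * y) ∈ G := by
  have hxy2 : x * y ^ 2 ≠ 0 := mul_ne_zero hx (pow_ne_zero _ hy)
  have hx2y : x ^ 2 * y ≠ 0 := mul_ne_zero (pow_ne_zero _ hx) hy
  have e1 : cubeClass (x ^ 2 * y) = cubeClass (x * y ^ 2) * cubeClass (x * y ^ 2) := by
    rw [← cubeClass_mul hxy2 hxy2, show x * y ^ 2 * (x * y ^ 2) = x ^ 2 * y * y ^ 3 by ring,
      cubeClass_mul_pow_three hx2y hy]
  have e2 : cubeClass (x * y ^ 2) = cubeClass (x ^ 2 * y) * cubeClass (x ^ 2 * y) := by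
    rw [← cubeClass_mul hx2y hx2y, show x ^ 2 * y * (x ^ 2 * y) = x * y ^ 2 * x ^ 3 by ring,
      cubeClass_mul_pow_three hxy2 hx]
  rcases h with h | h
  · exact ⟨h, by rw [e1]; exact G.mul_mem h h⟩
  · exact ⟨by rw [e2]; exact G.mul_mem h h, h⟩

/-- **The `α̂`-box over `K3` from two generators (one split prime).** For a Cohen–Pazuki pair
`cpCurve a₃ b₃ → threeTorsionModel m₃ s₃` over `K3` (`t m₃ = 3a₃`, `t³ s₃ = 4a₃³ + 9b₃`), `N ≠ 0` with inert prime
factors, a split prime `p = ϖϖ̄ ≡ 1 (3)` (`ϖ = a + bζ`, `a² − ab + b² = p`), `w(2s₃) = 1`, `w(2m₃) ≤ 1` at every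
`w ∌ 3Np`, `[ζ] ∈ G` and `[ϖϖ̄²] ∈ G` or `[ϖ²ϖ̄] ∈ G` for `G = ⟨[α̂(P)] : P ∈ Ê₃(K3)⟩`: every `μ₃`-torsor class
`[C_u]`, `u` of cube norm, lying in `Ш(V₃/K3)` vanishes. [cite: CohenPazuki2009, Theorem 2.1 and Proposition 2.2] -/
theorem torsorClass_eq_zero_of_mem_sha_of_norm_cube_of_gen₂ {N : ℕ} (hN0 : N ≠ 0)
    (hN : ∀ q ∈ N.primeFactors, q = 2 ∨ q % 3 = 2) {p : ℕ} (hp : p.Prime) (hp1 : p % 3 = 1) {a b : ℤ}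
    (hab : a ^ 2 - a * b + b ^ 2 = p) {a₃ b₃ t m₃ s₃ : K3} (hb₃ : b₃ ≠ 0)
    (hd₃ : 4 * a₃ ^ 3 + 9 * b₃ ≠ 0) (ht : t ≠ 0) (hm₃ : t * m₃ = 3 * a₃) (hs₃ : t ^ 3 * s₃ = 4 * a₃ ^ 3 + 9 * b₃)
    (hvs : ∀ w : HeightOneSpectrum (𝓞 K3), ((3 * N * p : ℕ) : 𝓞 K3) ∉ w.asIdeal → w.valuation K3 (2 * s₃) = 1)
    (hvm : ∀ w : HeightOneSpectrum (𝓞 K3), ((3 * N * p : ℕ) : 𝓞 K3) ∉ w.asIdeal → w.valuation K3 (2 * m₃) ≤ 1)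
    (hgen : cubeClass (zeta : K3) ∈ Subgroup.closure (Set.range
      fun P : (threeTorsionModel m₃ s₃).toAffine.Point => descentClass (threeTorsionModel m₃ s₃) m₃ s₃ P))
    (hgenϖ : cubeClass ((⟨a, b⟩ : K3) * (⟨a - b, -b⟩ : K3) ^ 2) ∈ Subgroup.closure (Set.range
        fun P : (threeTorsionModel m₃ s₃).toAffine.Point => descentClass (threeTorsionModel m₃ s₃) m₃ s₃ P) ∨
      cubeClass ((⟨a, b⟩ : K3) ^ 2 * (⟨a - b, -b⟩ : K3)) ∈ Subgroup.closure (Set.range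
        fun P : (threeTorsionModel m₃ s₃).toAffine.Point => descentClass (threeTorsionModel m₃ s₃) m₃ s₃ P))
    {u : K3} (hu : u ≠ 0) (hsha : (kernelDatum hb₃ hd₃).torsorClass hu ∈ (cpCurve a₃ b₃).sha)
    (hnorm : ∃ r : ℚ, QuadraticAlgebra.norm u = r ^ 3) : (kernelDatum hb₃ hd₃).torsorClass hu = 0 := by
  set G := Subgroup.closure (Set.range
      fun P : (threeTorsionModel m₃ s₃).toAffine.Point => descentClass (threeTorsionModel m₃ s₃) m₃ s₃ P) with hG
  have hval : ∀ w : HeightOneSpectrum (𝓞 K3), ((3 * N * p : ℕ) : 𝓞 K3) ∉ w.asIdeal →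
      (3 : ℤ) ∣ log (w.valuation K3 u) := by
    intro w hw
    obtain ⟨P, w', e, hw', hP⟩ :=
      exists_descent_pow_eq_adicCompletion_of_torsorClass_mem_sha hb₃ hd₃ ht hm₃ hs₃ hu hsha w
    have hval' : ∀ x : K3, Valued.v (algebraMap K3 (w.adicCompletion K3) x) = w.valuation K3 x :=
      fun x => valuedAdicCompletion_eq_valuation' w x
    have key := Carrier6137.three_dvd_log_of_descent_pow_eq' Valued.v (algebraMap K3 (w.adicCompletion K3))
      (by rw [hval']; exact hvs w hw) (by rw [hval']; exact hvm w hw) hu hw' hP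
    rwa [hval'] at key
  obtain ⟨i, k, l, -, -, -, hkl, hi⟩ := K3.exists_cubeClass_eq_of_norm_cube_split hN0 hN hp hp1 hab hu hval hnorm
  -- the class `[ζ^i ϖ^k ϖ̄^l]` lies in `G`
  have hz : (zeta : K3) ≠ 0 := isPrimitiveRoot_zeta.ne_zero (by norm_num)
  have hp0 : (p : ℤ) ≠ 0 := by exact_mod_cast hp.ne_zero
  have hϖ : (⟨a, b⟩ : K3) ≠ 0 := fun h0 => by
    have ha : (a : ℚ) = 0 := congrArg QuadraticAlgebra.re h0
    have hb : (b : ℚ) = 0 := congrArg QuadraticAlgebra.im h0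
    have ha' : a = 0 := by exact_mod_cast ha
    have hb' : b = 0 := by exact_mod_cast hb
    subst ha'; subst hb'
    exact hp0 (by rw [← hab]; ring)
  have hϖ' : (⟨a - b, -b⟩ : K3) ≠ 0 := fun h0 => by
    have ha : (a : ℚ) - b = 0 := congrArg QuadraticAlgebra.re h0
    have hb : -(b : ℚ) = 0 := congrArg QuadraticAlgebra.im h0
    have hb' : b = 0 := by exact_mod_cast (neg_eq_zero.mp hb)
    subst hb'
    have ha' : a = 0 := by exact_mod_cast (show (a : ℚ) = 0 by simpa using ha)
    subst ha'
    exact hp0 (by rw [← hab]; ring)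
  obtain ⟨h12, h21⟩ := cubeClass_varpi_mem_and hϖ hϖ' hgenϖ
  have hmem : cubeClass ((zeta : K3) ^ i * (⟨a, b⟩ : K3) ^ k * (⟨a - b, -b⟩ : K3) ^ l) ∈ G := by
    have hzi := cubeClass_zeta_pow_mem' hgen i
    rcases hkl with ⟨rfl, rfl⟩ | ⟨rfl, rfl⟩ | ⟨rfl, rfl⟩
    · rw [pow_zero, pow_zero, mul_one, mul_one]; exact hzi
    · rw [pow_one, mul_assoc, cubeClass_mul (pow_ne_zero _ hz) (mul_ne_zero hϖ (pow_ne_zero _ hϖ'))]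
      exact G.mul_mem hzi h12
    · rw [pow_one, mul_assoc, cubeClass_mul (pow_ne_zero _ hz) (mul_ne_zero (pow_ne_zero _ hϖ) hϖ')]
      exact G.mul_mem hzi h21
  rw [(kernelDatum hb₃ hd₃).torsorClass_eq_zero_iff_cubeClass_mem_ker hu, hi, MonoidHom.mem_ker]
  exact torsorClassQuotHom_eq_one_of_mem_closure hb₃ hd₃ ht hm₃ hs₃ hmem

/-! ## Booking a cross-prime cell at `3` with one split prime -/

/-- `((3 * N * p : ℕ)) ∉ w ⇒ ((3 * (N * p) : ℕ)) ∉ w` (reassociation for the `CPMuDescentK3Box` dischargers, private).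
[cite: CohenPazuki2009, Theorem 2.1 (2)] -/
private theorem not_mem_assoc {N p : ℕ} {w : HeightOneSpectrum (𝓞 K3)} (hw : ((3 * N * p : ℕ) : 𝓞 K3) ∉ w.asIdeal) :
    ((3 * (N * p) : ℕ) : 𝓞 K3) ∉ w.asIdeal := by
  rwa [← mul_assoc]

/-- **`Ш(E/ℚ)[3] = 0` for `E = threeTorsionModel m s` from generators on both sides, one split prime.** Inputs:
(ℚ-side) `S` outside which `v_q(2s) = 0 ≤ v_q(2m)`, and `[q] ∈ ⟨[α(P)] : P ∈ E(ℚ)⟩` for `q ∈ S`; (`K3`-side) `N ≠ 0`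
with inert prime factors and a split prime `p = ϖϖ̄ ≡ 1 (3)`, `ϖ = a + bζ`, such that `w(2b̂) = 1`, `w(2m) ≤ 1` at
every place `w ∌ 3Np` (`b̂ = 3s − 4m³/9`), and, for each `θ₀ = ±√−3`, `[ζ] ∈ G_{θ₀}` and (`[ϖϖ̄²] ∈ G_{θ₀}` or
`[ϖ²ϖ̄] ∈ G_{θ₀}`), `G_{θ₀} = ⟨[α̂(P)] : P ∈ Ê₃(K3)⟩`, `Ê₃ = threeTorsionModel (mθ₀) (b̂θ₀)`, `α̂ = y − θ₀(mx + b̂)`.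
[cite: CohenPazuki2009, Proposition 2.2] [cite: SilvermanAEC2009, Thm. X.4.2 (a)] -/
theorem forall_mem_sha_three_nsmul_eq_zero_of_gens_split {m s : ℚ} [(threeTorsionModel m s).IsElliptic]
    (S : Finset ℕ) (hS : ∀ q ∈ S, q.Prime)
    (hout : ∀ q : ℕ, q.Prime → q ∉ S → padicValRat q (2 * s) = 0 ∧ 0 ≤ padicValRat q (2 * m))
    (hgen : ∀ q ∈ S, cubeClass (q : ℚ) ∈ Subgroup.closure (Set.range
      fun P : (threeTorsionModel m s).toAffine.Point => descentClass (threeTorsionModel m s) m s P))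
    {N : ℕ} (hN0 : N ≠ 0) (hN : ∀ q ∈ N.primeFactors, q = 2 ∨ q % 3 = 2)
    {p : ℕ} (hp : p.Prime) (hp1 : p % 3 = 1) {a b : ℤ} (hab : a ^ 2 - a * b + b ^ 2 = p)
    (hvb : ∀ w : HeightOneSpectrum (𝓞 K3), ((3 * N * p : ℕ) : 𝓞 K3) ∉ w.asIdeal →
      w.valuation K3 (algebraMap ℚ K3 (2 * (3 * s - 4 * m ^ 3 / 9))) = 1)
    (hvm : ∀ w : HeightOneSpectrum (𝓞 K3), ((3 * N * p : ℕ) : 𝓞 K3) ∉ w.asIdeal →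
      w.valuation K3 (algebraMap ℚ K3 (2 * m)) ≤ 1)
    (hgen₃ : ∀ θ₀ : K3, θ₀ ^ 2 = -3 →
      cubeClass (zeta : K3) ∈ Subgroup.closure (Set.range
        fun P : (threeTorsionModel (algebraMap ℚ K3 m * θ₀) (algebraMap ℚ K3 (3 * s - 4 * m ^ 3 / 9) * θ₀)).toAffine.Point =>
          descentClass (threeTorsionModel (algebraMap ℚ K3 m * θ₀) (algebraMap ℚ K3 (3 * s - 4 * m ^ 3 / 9) * θ₀))
            (algebraMap ℚ K3 m * θ₀) (algebraMap ℚ K3 (3 * s - 4 * m ^ 3 / 9) * θ₀) P) ∧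
      (cubeClass ((⟨a, b⟩ : K3) * (⟨a - b, -b⟩ : K3) ^ 2) ∈ Subgroup.closure (Set.range
        fun P : (threeTorsionModel (algebraMap ℚ K3 m * θ₀) (algebraMap ℚ K3 (3 * s - 4 * m ^ 3 / 9) * θ₀)).toAffine.Point =>
          descentClass (threeTorsionModel (algebraMap ℚ K3 m * θ₀) (algebraMap ℚ K3 (3 * s - 4 * m ^ 3 / 9) * θ₀))
            (algebraMap ℚ K3 m * θ₀) (algebraMap ℚ K3 (3 * s - 4 * m ^ 3 / 9) * θ₀) P) ∨
       cubeClass ((⟨a, b⟩ : K3) ^ 2 * (⟨a - b, -b⟩ : K3)) ∈ Subgroup.closure (Set.range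
        fun P : (threeTorsionModel (algebraMap ℚ K3 m * θ₀) (algebraMap ℚ K3 (3 * s - 4 * m ^ 3 / 9) * θ₀)).toAffine.Point =>
          descentClass (threeTorsionModel (algebraMap ℚ K3 m * θ₀) (algebraMap ℚ K3 (3 * s - 4 * m ^ 3 / 9) * θ₀))
            (algebraMap ℚ K3 m * θ₀) (algebraMap ℚ K3 (3 * s - 4 * m ^ 3 / 9) * θ₀) P))) :
    ∀ c ∈ (threeTorsionModel m s).sha, 3 • c = 0 → c = 0 :=
  forall_mem_sha_three_nsmul_eq_zero_of_gens_of_box S hS hout hgen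
    (fun θ₀ => -(algebraMap ℚ K3 m / 3) * θ₀) (fun θ₀ => -(algebraMap ℚ K3 s / 3) * θ₀)
    (fun _ hθ => canonical₃_b_ne_zero (m := m) hθ) (fun _ hθ => canonical₃_d_ne_zero hθ)
    (fun _ hθ => canonical₃_baseChange_eq hθ) (fun _ hθ => canonical₃_hy hθ)
    (fun θ₀ hθ _ hu hsha hnorm => torsorClass_eq_zero_of_mem_sha_of_norm_cube_of_gen₂ hN0 hN hp hp1 hab
      (canonical₃_b_ne_zero (m := m) hθ) (canonical₃_d_ne_zero hθ) (t := -1) (by norm_num) canonical₃_hm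
      (canonical₃_hs hθ) (fun w hw => canonical₃_valuation_s hθ (not_mem_assoc hw) (hvb w hw))
      (fun w hw => canonical₃_valuation_m hθ (not_mem_assoc hw) (hvm w hw)) (hgen₃ θ₀ hθ).1 (hgen₃ θ₀ hθ).2
      hu hsha hnorm)

/-- **`t_3(E_{m,s}) = corank_{ℤ₃} Ш(E/ℚ)[3^∞] = 0` BOOKED from generators on both sides, one split prime** (the
`α`-box over `ℚ` from `S` and one rational point per `q ∈ S`; the `α̂`-box over `ℚ(√−3)` from the inert support `N`,
the split prime `p = ϖϖ̄`, and two descent classes `[ζ]`, `[ϖϖ̄²]^{±1}` per sign of `θ₀`).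
[cite: CohenPazuki2009, Proposition 2.2] [cite: SilvermanAEC2009, Thm. X.4.2 (a)] -/
theorem shaCorank_three_eq_zero_of_gens_split {m s : ℚ} [(threeTorsionModel m s).IsElliptic]
    (S : Finset ℕ) (hS : ∀ q ∈ S, q.Prime)
    (hout : ∀ q : ℕ, q.Prime → q ∉ S → padicValRat q (2 * s) = 0 ∧ 0 ≤ padicValRat q (2 * m))
    (hgen : ∀ q ∈ S, cubeClass (q : ℚ) ∈ Subgroup.closure (Set.range
      fun P : (threeTorsionModel m s).toAffine.Point => descentClass (threeTorsionModel m s) m s P))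
    {N : ℕ} (hN0 : N ≠ 0) (hN : ∀ q ∈ N.primeFactors, q = 2 ∨ q % 3 = 2)
    {p : ℕ} (hp : p.Prime) (hp1 : p % 3 = 1) {a b : ℤ} (hab : a ^ 2 - a * b + b ^ 2 = p)
    (hvb : ∀ w : HeightOneSpectrum (𝓞 K3), ((3 * N * p : ℕ) : 𝓞 K3) ∉ w.asIdeal →
      w.valuation K3 (algebraMap ℚ K3 (2 * (3 * s - 4 * m ^ 3 / 9))) = 1)
    (hvm : ∀ w : HeightOneSpectrum (𝓞 K3), ((3 * N * p : ℕ) : 𝓞 K3) ∉ w.asIdeal →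
      w.valuation K3 (algebraMap ℚ K3 (2 * m)) ≤ 1)
    (hgen₃ : ∀ θ₀ : K3, θ₀ ^ 2 = -3 →
      cubeClass (zeta : K3) ∈ Subgroup.closure (Set.range
        fun P : (threeTorsionModel (algebraMap ℚ K3 m * θ₀) (algebraMap ℚ K3 (3 * s - 4 * m ^ 3 / 9) * θ₀)).toAffine.Point =>
          descentClass (threeTorsionModel (algebraMap ℚ K3 m * θ₀) (algebraMap ℚ K3 (3 * s - 4 * m ^ 3 / 9) * θ₀))
            (algebraMap ℚ K3 m * θ₀) (algebraMap ℚ K3 (3 * s - 4 * m ^ 3 / 9) * θ₀) P) ∧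
      (cubeClass ((⟨a, b⟩ : K3) * (⟨a - b, -b⟩ : K3) ^ 2) ∈ Subgroup.closure (Set.range
        fun P : (threeTorsionModel (algebraMap ℚ K3 m * θ₀) (algebraMap ℚ K3 (3 * s - 4 * m ^ 3 / 9) * θ₀)).toAffine.Point =>
          descentClass (threeTorsionModel (algebraMap ℚ K3 m * θ₀) (algebraMap ℚ K3 (3 * s - 4 * m ^ 3 / 9) * θ₀))
            (algebraMap ℚ K3 m * θ₀) (algebraMap ℚ K3 (3 * s - 4 * m ^ 3 / 9) * θ₀) P) ∨
       cubeClass ((⟨a, b⟩ : K3) ^ 2 * (⟨a - b, -b⟩ : K3)) ∈ Subgroup.closure (Set.range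
        fun P : (threeTorsionModel (algebraMap ℚ K3 m * θ₀) (algebraMap ℚ K3 (3 * s - 4 * m ^ 3 / 9) * θ₀)).toAffine.Point =>
          descentClass (threeTorsionModel (algebraMap ℚ K3 m * θ₀) (algebraMap ℚ K3 (3 * s - 4 * m ^ 3 / 9) * θ₀))
            (algebraMap ℚ K3 m * θ₀) (algebraMap ℚ K3 (3 * s - 4 * m ^ 3 / 9) * θ₀) P))) :
    (threeTorsionModel m s).shaCorank 3 = 0 :=
  haveI : Fact (Nat.Prime 3) := ⟨Nat.prime_three⟩
  shaCorank_eq_zero_of_forall _ 3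
    (forall_mem_sha_three_nsmul_eq_zero_of_gens_split S hS hout hgen hN0 hN hp hp1 hab hvb hvm hgen₃)

end CPMuDescent

end Literature.NumberTheory.EllipticCurves

end
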